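import Literature.NumberTheory.EllipticCurves.JetchevSkinnerWan2017.SigmaLocalTotallySplitProofs
import Literature.NumberTheory.EllipticCurves.PrimaryTorsionLocalInvariantsGoodReductionProofs
import HarnessLib

/-!
# The local term of the `Σ`-change at a totally split place of GOOD reduction, modulo the count
# `#H¹(K_w, E[p^∞]) ∣ #E(K_w)[p^∞]` — PROVED (assembly of modules L3 and L4b)

Topic `Literature/NumberTheory/EllipticCurves/JetchevSkinnerWan2017` (sibling of the named LOCAL fact
`sigmaLocal_charIdeal_eulerFactor_mem_of_noTamagawaDefect`). THEOREMS ONLY (no definition, no named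
fact, no instance, no `sorry`; D-0026). Cell `bsd-stepL` (typer lane `defn-ty1`, g9): module L6
(assembly) of `HOME/defn-ty1/g9/NOTE-sigmaLocal-discharge-plan-defn-ty1-g9.md` at the totally split
places of GOOD reduction, CONDITIONAL on the one remaining local count (module L4a,
[GreenbergLNM1716] §2: `#H¹(K_v, E[p^∞]) = #E(K_v)[p^∞]` for `v ∤ p` of good reduction).

[Castella2018] Thm. 2.3 (2.7) / Prop. 2.5: at `w ∈ Σ`, `w ∤ p`, totally split in `K_∞` and of good
reduction, the local factor of `Ch_Λ(X^Σ)` is `(#H¹(K_w, E[p^∞])) = (#E(K_w)[p^∞]) ⊇ (#Ẽ_w(k_w))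
= (P_w|_{u=1})`.

## What is proved

* **`sigmaLocal_good_totallySplit_of_natCard_h1_dvd`** — for `W/K` (`K : Type`), a prime `p`, a
  `ℤ_p`-extension `κ`, a finite place `w ∤ p` with Euler datum `(Nw, good a, 0)` (so `W` has good
  reduction at `w` and `w` is totally split in `K_∞`), any topology on `Λ` making the action continuous,
  `H¹(K_w, E[p^∞])` finite with `#H¹(K_w, E[p^∞]) ∣ #E[p^∞]^{Γ_{K_w}}`: the THREE CONJUNCTS of the
  named local fact at `w` — the Pontryagin dual of `H¹(K_w, T_pE ⊗ Λ^*(Ψ⁻¹))` is finitely generated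
  and torsion over `Λ`, and `eulerFactor p ℤ_[p] Nw (.good a) 0 = Nw − a + 1 ∈ Ch_Λ` — from
  `moduleFinite_isTorsion_natCard_mem_charIdeal_of_isEulerDataAt_zero` (L3: `#H¹ ∈ Ch`) and
  `WeierstrassCurve.exists_eulerFactor_zero_eq_natCard_mul` (L4b: `P_w = #E[p^∞]^{Γ_{K_w}} · r`).

HONEST FRAMING: conditional on the hypothesis `hcount` (module L4a, in progress:
`PrimaryTorsionLocalGoodReductionFrobeniusProofs`, `PrimaryTorsionLocalH1InertiaRestrictionProofs`);
nothing at places of bad reduction or at finitely decomposed places; the named fact is NOT discharged.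

References: [Castella2018] Thm. 2.3 (2.7), Prop. 2.5; [GreenbergLNM1716] §2; [PollackWeston2011]
Lemma 3.2; [JetchevSkinnerWan2017] §5.1 (Remark on inert places).
-/

noncomputable section

open Field IsDedekindDomain NumberField WeierstrassCurve
open Literature.NumberTheory.GaloisRepresentations Literature.NumberTheory.EllipticCurves
  Literature.NumberTheory.EllipticCurves.BigGaloisRep Literature.NumberTheory.EllipticCurves.IwasawaCharacter

namespace Literature.NumberTheory.EllipticCurves.JetchevSkinnerWan2017

variable {K : Type} [Field K] [NumberField K]

/-- **The named local fact at a totally split place of GOOD reduction, modulo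
`#H¹(K_w, E[p^∞]) ∣ #E[p^∞]^{Γ_{K_w}}`.** For an elliptic curve `W/K`, a prime `p`, a `ℤ_p`-extension
`κ`, a finite place `w ∤ p` with Euler datum `(Nw, good a, 0)`, and any topology on `Λ` making the
action on `T_pE ⊗ Λ^*` continuous: if `H¹(K_w, E[p^∞])` is finite of order dividing the order of the
`Γ_{K_w}`-invariants of `E[p^∞]` (= `#E(K_w)[p^∞]`; [GreenbergLNM1716] §2), then the Pontryagin dual of
`H¹(K_w, T_pE ⊗ Λ^*(Ψ⁻¹))` is a finitely generated torsion `Λ`-module whose characteristic ideal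
contains the Euler factor `P_w = eulerFactor p ℤ_[p] Nw (.good a) 0 = Nw − a + 1 = #Ẽ_w(k_w)`.
[cite: Castella2018, Thm. 2.3 (2.7) and Prop. 2.5] [cite: PollackWeston2011, Lemma 3.2]
[cite: GreenbergLNM1716, §2 (p. 71, #H¹(K_v, E[p^∞]) at v ∤ p of good reduction)] -/
theorem sigmaLocal_good_totallySplit_of_natCard_h1_dvd
    (W : WeierstrassCurve K) [W.IsElliptic] (p : ℕ) [Fact p.Prime] (κ : ZpExtension K p)
    (w : HeightOneSpectrum (𝓞 K)) (hw : ((p : ℕ) : 𝓞 K) ∉ w.asIdeal) (Nw : ℕ) (a : ℤ)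
    (hdata : IsEulerDataAt W κ w Nw (.good a) 0)
    [TopologicalSpace (IwasawaAlgebra p)]
    [ContinuousSMul (IwasawaAlgebra p) (BigRepModule ℤ_[p] p (PrimaryTorsion (geomPoints W) p))]
    [ContinuousSMul ℤ_[p] (PrimaryTorsion (geomPoints W) p)]
    [Finite (continuousCohomology 1
      ((W.primaryTorsionGaloisRep p).restrict (localMap K (Sum.inl w))).toTopRep)]
    (hcount : Nat.card (continuousCohomology 1
        ((W.primaryTorsionGaloisRep p).restrict (localMap K (Sum.inl w))).toTopRep) ∣
      Nat.card ((W.primaryTorsionGaloisRep p).restrict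
        (localMap K (Sum.inl w))).toRepresentation.invariants) :
    Module.Finite (IwasawaAlgebra p) (CharacterModule (continuousCohomology 1
        ((AnticyclotomicBigGaloisRep κ (W.primaryTorsionGaloisRep p)).restrict
          (localMap K (Sum.inl w))).toTopRep)) ∧
      Module.IsTorsion (IwasawaAlgebra p) (CharacterModule (continuousCohomology 1
        ((AnticyclotomicBigGaloisRep κ (W.primaryTorsionGaloisRep p)).restrict
          (localMap K (Sum.inl w))).toTopRep)) ∧
        eulerFactor p ℤ_[p] Nw (.good a) 0 ∈
          Module.charIdeal (IwasawaAlgebra p) (CharacterModule (continuousCohomology 1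
            ((AnticyclotomicBigGaloisRep κ (W.primaryTorsionGaloisRep p)).restrict
              (localMap K (Sum.inl w))).toTopRep)) := by
  obtain ⟨hfg, htors, hmem⟩ :=
    moduleFinite_isTorsion_natCard_mem_charIdeal_of_isEulerDataAt_zero W p κ w hw Nw (.good a) hdata
  refine ⟨hfg, htors, ?_⟩
  obtain ⟨r, hr⟩ := W.exists_eulerFactor_zero_eq_natCard_mul p κ hw hdata
  obtain ⟨m, hm⟩ := hcount
  rw [hr, hm, Nat.cast_mul, mul_assoc]
  exact Ideal.mul_mem_right _ _ hmem

end Literature.NumberTheory.EllipticCurves.JetchevSkinnerWan2017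

end
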